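import Summits.Ventures.PercRepro.Night2FatBudget

/-!
# PercRepro — the fat-face budget WITH the face-sum constraint (night-2, gen 23)

`Night2FatBudget` charges every non-fat member face the flat `1/(3 + d)`.  Here the non-fat faces are charged through
the chord of `1/(m + d)` on `3 ≤ m ≤ n − ρ + 1` and the face-sum constraint `Σ_w m_w ≥ 2n − ρ` of gen 20
(`two_mul_card_le_sum_faces`) is kept: with at most `k` fat member faces (each missing exactly `2` points)

  `L1 Q ≤ Φ · (k/(2+d) + (ρ − k)·a − b·(2n − ρ − 2k))`

whenever `1/(m+d) ≤ a − b m` on `[3, n − ρ + 1]`, `b ≥ 0` and the charge is increasing in the number of fat faces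
(`a − 2b ≤ 1/(2+d)`).  **`sum_faceLoss_le_budgetFS`** / **`sum_faceLoss_budgetFS_union_le`**: the face losses of every
covering basis are at most `fatBudgetFS q d ρ k n a b` when the fat thin members of `G` have at most `k` closures.
At `(3, 0)`, `n = 12` (`a = 13/60`, `b = 1/60`): `37/180` for `k = 2`, `9/40` for `k = 3` (the flat budget gave
`11/45`, `17/60`) — the cell `|G| = 12` of `Night2FatBudgetFSCells`.
-/

namespace PercRepro.Shadow

open Finset PerFlat ThmH

/-- The fat-face budget with the face-sum constraint:
`Φ · (k/(2+d) + (ρ − k)·a − b·(2n − ρ − 2k)) − capDG`. -/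
noncomputable def fatBudgetFS (q d ρ k n : ℕ) (a b : ℚ) : ℚ :=
  phiQ q * ((k : ℚ) / (2 + (d : ℚ)) + ((ρ : ℚ) - (k : ℚ)) * a - b * (2 * (n : ℚ) - (ρ : ℚ) - 2 * (k : ℚ))) -
    capDG q d 0

/-- The chord of `1/(m + 3)` on `3 ≤ m ≤ 7` (`n = 12` at `(3, 0)`): `1/(m+3) ≤ 13/60 − m/60`. -/
theorem chord3_three_zero_12 : ∀ m : ℕ, 3 ≤ m → m ≤ 7 →
    1 / ((m : ℚ) + ((3 : ℕ) : ℚ)) ≤ (13 / 60 : ℚ) - (1 / 60 : ℚ) * (m : ℚ) := by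
  intro m h1 h2
  interval_cases m <;> norm_num

/-- `fatBudgetFS 5 3 6 3 12 (13/60) (1/60) = 9/40`. -/
theorem fatBudgetFS_three_zero_twelve_three : fatBudgetFS 5 3 6 3 12 (13 / 60 : ℚ) (1 / 60 : ℚ) = (9 / 40 : ℚ) := by
  unfold fatBudgetFS capDG phiQ; norm_num

variable {α : Type*} [DecidableEq α] {M : Matroid α} [M.Finite]

open scoped Classical in
/-- **THE FAT-FACE BUDGET WITH THE FACE-SUM CONSTRAINT**: at most `k` fat member faces, the non-fat faces through the
chord `1/(m+d) ≤ a − b m` on `[3, n − ρ + 1]` and `Σ_w m_w ≥ 2n − ρ`; the charge must be increasing in the number of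
fat faces (`a − 2b ≤ 1/(2+d)`). -/
theorem sum_faceLoss_le_budgetFS {q d ρ k : ℕ} {G : Finset α} (hG : G ∈ flatsQ M (q + 1))
    (hd : (gr M \ G).card = d) (hdq : d ≤ q) (hk : kColoops M G + ρ = q + 1) (hk0 : kColoops M G = 0)
    (hd1 : 1 ≤ d) (hs : ∀ e ∈ gr M, ∀ f ∈ gr M, e ≠ f → rkN M {e, f} = 2) (hl : ∀ e ∈ gr M, M.Indep {e})
    {a b : ℚ} (hb : 0 ≤ b) (hh : 3 ≤ (G \ coloops M G).card - ρ + 1)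
    (hchord : ∀ m : ℕ, 3 ≤ m → m ≤ (G \ coloops M G).card - ρ + 1 →
      1 / ((m : ℚ) + (d : ℚ)) ≤ a - b * (m : ℚ))
    (hslope : a - 2 * b ≤ 1 / (2 + (d : ℚ)))
    (hE : 0 ≤ fatBudgetFS q d ρ k (G \ coloops M G).card a b)
    {Q : Finset α} (hQ : Q ∈ shadowAt M (q + 2) q (Uq M (q + 2) q) G) (hQc : (Q \ coloops M G).card = ρ)
    (hfat : ((Q \ coloops M G).filter
      (fun w => Q.erase w ∈ thinMembers M q G ∧ (G \ clF M (Q.erase w)).card ≤ 2)).card ≤ k) :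
    ∑ w ∈ Q \ coloops M G, faceLoss M q G Q w ≤ fatBudgetFS q d ρ k (G \ coloops M G).card a b := by
  have hd' : (gr M \ G).card ≤ q := by omega
  have hQG : Q ⊆ G := subset_G_of_mem_shadowAt hQ
  have hcap : 0 ≤ capS M q G Q := capS_nonneg' hG hd' Q
  have hcapDG : capDG q d (kColoops M G) ≤ capS M q G Q := by
    unfold capDG; exact capS_ge_one_sub_kColoops (q := q) hd hQG
  rw [hk0] at hcapDG
  set n := (G \ coloops M G).card with hn
  set W := (Q \ coloops M G).filter (fun w => Q.erase w ∈ thinMembers M q G) with hW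
  set F := (Q \ coloops M G).filter
    (fun w => Q.erase w ∈ thinMembers M q G ∧ (G \ clF M (Q.erase w)).card ≤ 2) with hF
  have hFW : F ⊆ W := by
    intro w hw
    rw [hF, Finset.mem_filter] at hw
    rw [hW, Finset.mem_filter]
    exact ⟨hw.1, hw.2.1⟩
  have hWQ : W ⊆ Q \ coloops M G := Finset.filter_subset _ _
  have hFQ : F ⊆ Q \ coloops M G := Finset.filter_subset _ _
  have hd2 : (0 : ℚ) < 2 + (d : ℚ) := by positivity
  -- every face misses at most `n − ρ + 1` points, and at least `2`
  have hface_le : ∀ w ∈ Q \ coloops M G, (G \ clF M (Q.erase w)).card ≤ n - ρ + 1 := by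
    intro w _
    have h1 := card_face_le hG hQ (w := w)
    have h2 := card_sdiff_add_eq_of_mem_shadowAt hQ hQc
    omega
  have hface_ge : ∀ w ∈ Q \ coloops M G, 2 ≤ (G \ clF M (Q.erase w)).card :=
    fun w hw => two_le_card_face hk hQ hQc hw
  -- the chord is nonnegative on every face
  have hchord_nonneg : ∀ w ∈ Q \ coloops M G, 0 ≤ a - b * ((G \ clF M (Q.erase w)).card : ℚ) := by
    intro w hw
    have hm := hface_le w hw
    have hcast : ((G \ clF M (Q.erase w)).card : ℚ) ≤ ((n - ρ + 1 : ℕ) : ℚ) := by exact_mod_cast hm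
    have hend := hchord (n - ρ + 1) hh le_rfl
    have hpos : (0 : ℚ) ≤ 1 / (((n - ρ + 1 : ℕ) : ℚ) + (d : ℚ)) := by positivity
    nlinarith [mul_le_mul_of_nonneg_left hcast hb]
  -- the member faces: fat ones at `1/(2+d)`, the others through the chord
  have hsplit : ∑ w ∈ W, 1 / (((G \ clF M (Q.erase w)).card : ℚ) + (d : ℚ)) ≤
      (F.card : ℚ) / (2 + (d : ℚ)) +
        ∑ w ∈ (Q \ coloops M G) \ F, (a - b * ((G \ clF M (Q.erase w)).card : ℚ)) := by
    rw [← Finset.sum_sdiff hFW]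
    have hFsum : ∑ w ∈ F, 1 / (((G \ clF M (Q.erase w)).card : ℚ) + (d : ℚ)) ≤ (F.card : ℚ) / (2 + (d : ℚ)) := by
      calc ∑ w ∈ F, 1 / (((G \ clF M (Q.erase w)).card : ℚ) + (d : ℚ))
          ≤ ∑ _w ∈ F, 1 / (2 + (d : ℚ)) := by
            apply Finset.sum_le_sum
            intro w hw
            have hm := hface_ge w (hFQ hw)
            apply one_div_le_one_div_of_le hd2
            have : (2 : ℚ) ≤ ((G \ clF M (Q.erase w)).card : ℚ) := by exact_mod_cast hm
            linarith
        _ = (F.card : ℚ) / (2 + (d : ℚ)) := by rw [Finset.sum_const, nsmul_eq_mul, mul_one_div]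
    have hRsum : ∑ w ∈ W \ F, 1 / (((G \ clF M (Q.erase w)).card : ℚ) + (d : ℚ)) ≤
        ∑ w ∈ (Q \ coloops M G) \ F, (a - b * ((G \ clF M (Q.erase w)).card : ℚ)) := by
      calc ∑ w ∈ W \ F, 1 / (((G \ clF M (Q.erase w)).card : ℚ) + (d : ℚ))
          ≤ ∑ w ∈ W \ F, (a - b * ((G \ clF M (Q.erase w)).card : ℚ)) := by
            apply Finset.sum_le_sum
            intro w hw
            rw [Finset.mem_sdiff] at hw
            have hwW := hw.1
            rw [hW, Finset.mem_filter] at hwW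
            have hm : 3 ≤ (G \ clF M (Q.erase w)).card := by
              by_contra hlt
              push Not at hlt
              apply hw.2
              rw [hF, Finset.mem_filter]
              exact ⟨hwW.1, hwW.2, by omega⟩
            exact hchord _ hm (hface_le w hwW.1)
        _ ≤ ∑ w ∈ (Q \ coloops M G) \ F, (a - b * ((G \ clF M (Q.erase w)).card : ℚ)) := by
            apply Finset.sum_le_sum_of_subset_of_nonneg
            · exact Finset.sdiff_subset_sdiff hWQ le_rfl
            · intro w hw _
              exact hchord_nonneg w (Finset.mem_sdiff.1 hw).1
    linarith
  -- the chord sum over the non-fat faces through the face-sum constraint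
  have hFS := two_mul_card_le_sum_faces hG hk hs hl hQ hQc
  rw [← hn] at hFS
  have hsumF : ∑ w ∈ F, (G \ clF M (Q.erase w)).card ≤ 2 * F.card := by
    calc ∑ w ∈ F, (G \ clF M (Q.erase w)).card ≤ ∑ _w ∈ F, 2 := by
          apply Finset.sum_le_sum
          intro w hw
          exact (Finset.mem_filter.1 hw).2.2
      _ = 2 * F.card := by rw [Finset.sum_const, smul_eq_mul, mul_comm]
  have hsumsplit : ∑ w ∈ Q \ coloops M G, (G \ clF M (Q.erase w)).card =
      ∑ w ∈ (Q \ coloops M G) \ F, (G \ clF M (Q.erase w)).card + ∑ w ∈ F, (G \ clF M (Q.erase w)).card :=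
    (Finset.sum_sdiff hFQ).symm
  have hcardsplit : ((Q \ coloops M G) \ F).card + F.card = ρ := by
    rw [Finset.card_sdiff_of_subset hFQ, hQc]
    have : F.card ≤ ρ := by rw [← hQc]; exact Finset.card_le_card hFQ
    omega
  have hrest : ∑ w ∈ (Q \ coloops M G) \ F, (a - b * ((G \ clF M (Q.erase w)).card : ℚ)) ≤
      ((ρ : ℚ) - (F.card : ℚ)) * a - b * (2 * (n : ℚ) - (ρ : ℚ) - 2 * (F.card : ℚ)) := by
    rw [Finset.sum_sub_distrib, Finset.sum_const, nsmul_eq_mul, ← Finset.mul_sum]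
    have hc : (((Q \ coloops M G) \ F).card : ℚ) = (ρ : ℚ) - (F.card : ℚ) := by
      have := hcardsplit
      have h' : ((((Q \ coloops M G) \ F).card + F.card : ℕ) : ℚ) = (ρ : ℚ) := by exact_mod_cast this
      push_cast at h'
      linarith
    rw [hc]
    have hlow : 2 * (n : ℚ) - (ρ : ℚ) - 2 * (F.card : ℚ) ≤
        ∑ w ∈ (Q \ coloops M G) \ F, ((G \ clF M (Q.erase w)).card : ℚ) := by
      have h1 : ((2 * n : ℕ) : ℚ) ≤ ((ρ + ∑ w ∈ Q \ coloops M G, (G \ clF M (Q.erase w)).card : ℕ) : ℚ) := by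
        exact_mod_cast hFS
      have h2 : ((∑ w ∈ Q \ coloops M G, (G \ clF M (Q.erase w)).card : ℕ) : ℚ) =
          ((∑ w ∈ (Q \ coloops M G) \ F, (G \ clF M (Q.erase w)).card : ℕ) : ℚ) +
          ((∑ w ∈ F, (G \ clF M (Q.erase w)).card : ℕ) : ℚ) := by
        rw [hsumsplit]; push_cast; ring
      have h3 : ((∑ w ∈ F, (G \ clF M (Q.erase w)).card : ℕ) : ℚ) ≤ 2 * (F.card : ℚ) := by
        exact_mod_cast hsumF
      push_cast at h1 h2 h3 ⊢
      linarith
    nlinarith [mul_le_mul_of_nonneg_left hlow hb]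
  -- the charge is increasing in the number of fat faces
  have hmono : (F.card : ℚ) / (2 + (d : ℚ)) + (((ρ : ℚ) - (F.card : ℚ)) * a - b * (2 * (n : ℚ) - (ρ : ℚ) - 2 * (F.card : ℚ))) ≤
      (k : ℚ) / (2 + (d : ℚ)) + ((ρ : ℚ) - (k : ℚ)) * a - b * (2 * (n : ℚ) - (ρ : ℚ) - 2 * (k : ℚ)) := by
    have hFk : (F.card : ℚ) ≤ (k : ℚ) := by exact_mod_cast hfat
    have e : ∀ j : ℚ, j / (2 + (d : ℚ)) + (((ρ : ℚ) - j) * a - b * (2 * (n : ℚ) - (ρ : ℚ) - 2 * j)) =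
        j * (1 / (2 + (d : ℚ)) - (a - 2 * b)) + ((ρ : ℚ) * a - b * (2 * (n : ℚ) - (ρ : ℚ))) := by
      intro j
      field_simp
      ring
    rw [e (F.card : ℚ), show (k : ℚ) / (2 + (d : ℚ)) + ((ρ : ℚ) - (k : ℚ)) * a -
        b * (2 * (n : ℚ) - (ρ : ℚ) - 2 * (k : ℚ)) = (k : ℚ) / (2 + (d : ℚ)) +
        (((ρ : ℚ) - (k : ℚ)) * a - b * (2 * (n : ℚ) - (ρ : ℚ) - 2 * (k : ℚ))) by ring, e (k : ℚ)]
    have := mul_le_mul_of_nonneg_right hFk (sub_nonneg.2 hslope)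
    linarith
  have hL1 : L1 M q G Q ≤ phiQ q * ((k : ℚ) / (2 + (d : ℚ)) + ((ρ : ℚ) - (k : ℚ)) * a -
      b * (2 * (n : ℚ) - (ρ : ℚ) - 2 * (k : ℚ))) := by
    have h1 := L1_le_sum_memberFaces hG hd hd1 hdq hQ
    rw [← hW] at h1
    refine h1.trans (mul_le_mul_of_nonneg_left ?_ (phiQ_pos q).le)
    linarith [hsplit, hrest, hmono]
  calc ∑ w ∈ Q \ coloops M G, faceLoss M q G Q w ≤ L1 M q G Q * (1 - fS M q G Q) :=
        sum_faceLoss_le_L1_mul hG hd' Q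
    _ ≤ max 0 (L1 M q G Q - capS M q G Q) := L1_mul_one_sub_fS_le hcap
    _ ≤ fatBudgetFS q d ρ k n a b := by
        apply max_le hE
        unfold fatBudgetFS
        linarith

open scoped Classical in
/-- The fatBudget with the face-sum constraint for a covering basis `K ∪ T` given through its `ρ`-subset `T`. -/
theorem sum_faceLoss_budgetFS_union_le {q d ρ k : ℕ} {G : Finset α} (hG : G ∈ flatsQ M (q + 1))
    (hd : (gr M \ G).card = d) (hdq : d ≤ q) (hk : kColoops M G + ρ = q + 1) (hk0 : kColoops M G = 0)
    (hd1 : 1 ≤ d) (hs : ∀ e ∈ gr M, ∀ f ∈ gr M, e ≠ f → rkN M {e, f} = 2) (hl : ∀ e ∈ gr M, M.Indep {e})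
    {a b : ℚ} (hb : 0 ≤ b) (hh : 3 ≤ (G \ coloops M G).card - ρ + 1)
    (hchord : ∀ m : ℕ, 3 ≤ m → m ≤ (G \ coloops M G).card - ρ + 1 →
      1 / ((m : ℚ) + (d : ℚ)) ≤ a - b * (m : ℚ))
    (hslope : a - 2 * b ≤ 1 / (2 + (d : ℚ)))
    (hE : 0 ≤ fatBudgetFS q d ρ k (G \ coloops M G).card a b)
    (hcl : (fatClosures M q G 2).card ≤ k)
    {S : Finset α} {T : Finset α} (hT : T ∈ (S \ coloops M G).powersetCard ρ) :
    ∑ w ∈ T, faceLoss M q G (coloops M G ∪ T) w ≤ fatBudgetFS q d ρ k (G \ coloops M G).card a b := by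
  rw [Finset.mem_powersetCard] at hT
  obtain ⟨hTS, hTc⟩ := hT
  have hTK : Disjoint (coloops M G) T := by
    rw [Finset.disjoint_left]
    intro x hx hxT
    exact (Finset.mem_sdiff.1 (hTS hxT)).2 hx
  have hQc : ((coloops M G ∪ T) \ coloops M G).card = ρ := by
    rw [Finset.union_sdiff_cancel_left hTK, hTc]
  have hQT : (coloops M G ∪ T) \ coloops M G = T := Finset.union_sdiff_cancel_left hTK
  by_cases hQ : coloops M G ∪ T ∈ shadowAt M (q + 2) q (Uq M (q + 2) q) G
  · have hfat := (card_fatFaces_le_card_fatClosures (m := 2) hG hk hQ hQc).trans hcl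
    have := sum_faceLoss_le_budgetFS hG hd hdq hk hk0 hd1 hs hl hb hh hchord hslope hE hQ hQc hfat
    rwa [hQT] at this
  · have hzero : ∀ w ∈ T, faceLoss M q G (coloops M G ∪ T) w = 0 := by
      intro w hw
      unfold faceLoss
      rw [if_neg]
      rintro ⟨hthin, hwc⟩
      apply hQ
      have := insert_mem_shadowAt_thin hG hthin hwc
      rwa [Finset.insert_erase (Finset.mem_union_right _ hw)] at this
    rw [Finset.sum_eq_zero hzero]
    exact hE

end PercRepro.Shadow
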